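import Mathlib.GroupTheory.OrderOfElement
import Mathlib.Algebra.BigOperators.Group.Finset.Basic
import Mathlib.Algebra.Order.BigOperators.Group.Finset
import Mathlib.Tactic.IntervalCases
import Mathlib.Tactic.Linarith
import Mathlib.Tactic.Positivity
import Mathlib.Tactic.FieldSimp
import Mathlib.Tactic.Ring
import HarnessLib

/-!
# Finiteness of the Galois–Prym locus: the arithmetic skeleton (WEIL-2 gen 41, HABITAT-G41, fact-free)

research route, not a corollary; conditional on HC_CM plus one named minimal statement.

Cell `pub-hodge-ring2-ab-*` (ALL ABELIAN VARIETIES), seat WEIL-2 gen 41, account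
`run/shared/lean/pub/pub-hodge-ring2/pub-hodge-ring2-ab-weil-2/HABITAT-G41.md`.

Informal setting.  For `G = ℤ/f ⋊ H`, `H = ker χ_K ⊂ (ℤ/f)^×` (an ABELIAN group of order `N = |H| = φ(f)/2`) and the
Hecke `K`-piece `τ = Ind ψ`, the Chevalley–Weil contribution `c(C) = |H| − dim τ^g` of a branch point is either `|H|` or
`|H|(1 − 1/d)`, `d` the order of the `H`-part (DEFECT DICHOTOMY, HABITAT-G41 §1.1), and a `τ`-piece of `K`-rank `2n` over a
base of genus `g_Y` with `r` branch points has `∑_P c(C_P) = 2n − 2|H|(g_Y − 1)`.  Consequently (HABITAT-G41 §1.1 COROLLARY 1.2 and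
§1.3 THEOREM 1.3; docstring locators corrected in REV 2 of this header, F-ab-201 (i)/(iii), ab-ref R-145 — no declaration changed):
* `r ≤ 4 + 4n/|H|` over `ℙ¹` (section `bounds`, `card_mul_le_of_half_le`), so families of dimension `≥ 2` need `|H| ≤ 4n`;
* three-point data: writing `I = {i : e_i > 0}` for the `H`-type points of maximal defect (`e_i = |H|/d_i`, `d_i = ord s_i ≥ 2`),
  `Σ_{i∈I} 1/d_i = 1 − 2n/|H|`; the cases `|I| ≤ 1` (`Σ ≤ 1/2`, `|H| ≤ 4n`) and `|I| = 2` (third point `N`-type: `d₁ = d₂ ≥ 3`,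
  `|H| ≤ 6n`; third point `H`-type of non-maximal defect: `Σ ≤ 5/6`, `|H| ≤ 12n`) are elementary (HABITAT-G41 §1.3, not kernelised
  separately), and for `|I| = 3`, i.e. `1/d₁ + 1/d₂ + 1/d₃ = 1 − 2n/|H|` with all `d_i ≥ 2`, the hyperbolic-triple bound `41/42`
  (section `egyptian` below) gives `|H| ≤ 84 n` for ANY `H`, and since `H` is abelian the orders of a product-one triple satisfy
  `d₃ ∣ lcm(d₁,d₂)` (and cyclically, section `abelian`), which improves the bound to `5/6` and `|H| ≤ 12 n` (section `bounds`);
* four-point data: `11/6` for any `H` (`|H| ≤ 12n`) and `5/3` for abelian `H` (`|H| ≤ 6n`, section `abelian_four`, append v2);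
hence for each `n` only finitely many levels `f` (those with `φ(f) ≤ 24 n`) carry a Galois–Prym piece of `K`-rank `2n`, and the
habitat classification of HABITAT-G41 §3 (all `f`, `n ≤ 4`) is a finite computation.

0 sorry, no `def`, no named fact; `HC_CM` does not occur.
-/

namespace Summit.HodgeConjecture.Ring2AbelianAll.GaloisPrymFiniteness

open Finset

section egyptian

/-- `2 ≤ d` gives `1/d ≤ 1/2` in `ℚ`.  research route, not a corollary; conditional on HC_CM plus one named minimal statement. -/
theorem one_div_le_of_le {d m : ℕ} (hm : 0 < m) (h : m ≤ d) : (1:ℚ) / d ≤ 1 / m := by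
  have hm' : (0:ℚ) < m := by exact_mod_cast hm
  have h' : (m:ℚ) ≤ d := by exact_mod_cast h
  exact one_div_le_one_div_of_le hm' h'

/-- **The hyperbolic-triple bound** (`(2,3,7)` is extremal): for naturals `2 ≤ a ≤ b ≤ c` with `1/a + 1/b + 1/c < 1` one has
`1/a + 1/b + 1/c ≤ 41/42`.  [locator HABITAT-G41 §1.3]
research route, not a corollary; conditional on HC_CM plus one named minimal statement. -/
theorem sum_inv_three_le {a b c : ℕ} (ha : 2 ≤ a) (hab : a ≤ b) (hbc : b ≤ c)
    (hlt : (1:ℚ) / a + 1 / b + 1 / c < 1) : (1:ℚ) / a + 1 / b + 1 / c ≤ 41 / 42 := by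
  have hcpos : (0:ℚ) < c := by have : (2:ℕ) ≤ c := le_trans ha (le_trans hab hbc); exact_mod_cast (lt_of_lt_of_le (by norm_num) this)
  have hc0 : (0:ℚ) < 1 / c := by positivity
  rcases (Nat.lt_or_ge a 4).symm with h4 | h4
  · -- all ≥ 4
    have h1 : (1:ℚ) / a ≤ 1 / 4 := one_div_le_of_le (by norm_num) h4
    have h2 : (1:ℚ) / b ≤ 1 / 4 := one_div_le_of_le (by norm_num) (le_trans h4 hab)
    have h3 : (1:ℚ) / c ≤ 1 / 4 := one_div_le_of_le (by norm_num) (le_trans h4 (le_trans hab hbc))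
    linarith
  · interval_cases a
    · -- a = 2
      rcases (Nat.lt_or_ge b 5).symm with h5 | h5
      · have h2 : (1:ℚ) / b ≤ 1 / 5 := one_div_le_of_le (by norm_num) h5
        have h3 : (1:ℚ) / c ≤ 1 / 5 := one_div_le_of_le (by norm_num) (le_trans h5 hbc)
        norm_num at h2 h3 ⊢; linarith
      · interval_cases b
        · norm_num at hlt; linarith
        · -- b = 3: c ≥ 7
          rcases (Nat.lt_or_ge c 7).symm with h7 | h7
          · have h3 : (1:ℚ) / c ≤ 1 / 7 := one_div_le_of_le (by norm_num) h7
            norm_num at h3 ⊢; linarith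
          · interval_cases c <;> norm_num at hlt
        · -- b = 4: c ≥ 5
          rcases (Nat.lt_or_ge c 5).symm with h5c | h5c
          · have h3 : (1:ℚ) / c ≤ 1 / 5 := one_div_le_of_le (by norm_num) h5c
            norm_num at h3 ⊢; linarith
          · interval_cases c; norm_num at hlt
    · -- a = 3
      rcases (Nat.lt_or_ge b 4).symm with h4b | h4b
      · have h2 : (1:ℚ) / b ≤ 1 / 4 := one_div_le_of_le (by norm_num) h4b
        have h3 : (1:ℚ) / c ≤ 1 / 4 := one_div_le_of_le (by norm_num) (le_trans h4b hbc)
        norm_num at h2 h3 ⊢; linarith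
      · interval_cases b
        -- b = 3: c ≥ 4
        rcases (Nat.lt_or_ge c 4).symm with h4c | h4c
        · have h3 : (1:ℚ) / c ≤ 1 / 4 := one_div_le_of_le (by norm_num) h4c
          norm_num at h3 ⊢; linarith
        · interval_cases c; norm_num at hlt

/-- **The abelian refinement**: if moreover `c ∣ lcm(a,b)`, `b ∣ lcm(a,c)`, `a ∣ lcm(b,c)` (the orders of a product-one
triple in an ABELIAN group, §2), then `1/a + 1/b + 1/c < 1` forces `1/a + 1/b + 1/c ≤ 5/6` (`(2,6,6)`, `(3,4,4)`… the
triple `(2,3,7)` cannot occur).  [locator HABITAT-G41 §1.3]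
research route, not a corollary; conditional on HC_CM plus one named minimal statement. -/
theorem sum_inv_three_le_of_dvd_lcm {a b c : ℕ} (ha : 2 ≤ a) (hab : a ≤ b) (hbc : b ≤ c)
    (h1 : c ∣ Nat.lcm a b) (h3 : a ∣ Nat.lcm b c)
    (hlt : (1:ℚ) / a + 1 / b + 1 / c < 1) : (1:ℚ) / a + 1 / b + 1 / c ≤ 5 / 6 := by
  have hc2 : 2 ≤ c := le_trans ha (le_trans hab hbc)
  have hcpos : (0:ℚ) < c := by exact_mod_cast (lt_of_lt_of_le (by norm_num) hc2)
  have hc0 : (0:ℚ) < 1 / c := by positivity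
  rcases (Nat.lt_or_ge a 4).symm with h4 | h4
  · have e1 : (1:ℚ) / a ≤ 1 / 4 := one_div_le_of_le (by norm_num) h4
    have e2 : (1:ℚ) / b ≤ 1 / 4 := one_div_le_of_le (by norm_num) (le_trans h4 hab)
    have e3 : (1:ℚ) / c ≤ 1 / 4 := one_div_le_of_le (by norm_num) (le_trans h4 (le_trans hab hbc))
    linarith
  · interval_cases a
    · -- a = 2
      rcases (Nat.lt_or_ge b 7).symm with h7 | h7
      · have e2 : (1:ℚ) / b ≤ 1 / 7 := one_div_le_of_le (by norm_num) h7
        have e3 : (1:ℚ) / c ≤ 1 / 7 := one_div_le_of_le (by norm_num) (le_trans h7 hbc)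
        norm_num at e2 e3 ⊢; linarith
      · interval_cases b
        · norm_num at hlt; linarith
        · -- b = 3: c ∣ 6
          rw [show Nat.lcm 2 3 = 6 by decide] at h1
          have hc6 : c ≤ 6 := Nat.le_of_dvd (by norm_num) h1
          interval_cases c
          · norm_num at hlt
          · norm_num at h1
          · norm_num at h1
          · norm_num at hlt
        · -- b = 4: c ∣ 4
          rw [show Nat.lcm 2 4 = 4 by decide] at h1
          have hc4 : c ≤ 4 := Nat.le_of_dvd (by norm_num) h1
          interval_cases c; norm_num at hlt
        · -- b = 5: c ∣ 10
          rw [show Nat.lcm 2 5 = 10 by decide] at h1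
          have hc10 : c ≤ 10 := Nat.le_of_dvd (by norm_num) h1
          interval_cases c
          · rw [show Nat.lcm 5 5 = 5 by decide] at h3; norm_num at h3
          · norm_num at h1
          · norm_num at h1
          · norm_num at h1
          · norm_num at h1
          · norm_num
        · -- b = 6: c ∣ 6
          rw [show Nat.lcm 2 6 = 6 by decide] at h1
          have hc6 : c ≤ 6 := Nat.le_of_dvd (by norm_num) h1
          interval_cases c; norm_num
    · -- a = 3
      rcases (Nat.lt_or_ge b 5).symm with h5 | h5
      · have e2 : (1:ℚ) / b ≤ 1 / 5 := one_div_le_of_le (by norm_num) h5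
        have e3 : (1:ℚ) / c ≤ 1 / 5 := one_div_le_of_le (by norm_num) (le_trans h5 hbc)
        norm_num at e2 e3 ⊢; linarith
      · interval_cases b
        · -- b = 3: c ∣ 3
          rw [show Nat.lcm 3 3 = 3 by decide] at h1
          have hc3 : c ≤ 3 := Nat.le_of_dvd (by norm_num) h1
          interval_cases c; norm_num at hlt
        · -- b = 4: c ∣ 12
          rw [show Nat.lcm 3 4 = 12 by decide] at h1
          have hc12 : c ≤ 12 := Nat.le_of_dvd (by norm_num) h1
          interval_cases c
          · norm_num
          · norm_num at h1
          · norm_num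
          · norm_num at h1
          · norm_num at h1
          · norm_num at h1
          · norm_num at h1
          · norm_num at h1
          · norm_num

end egyptian

section abelian

variable {A : Type*} [CommGroup A]

/-- In a commutative group, if `x y z = 1` then `orderOf z ∣ lcm (orderOf x) (orderOf y)`.  (Mathlib:
`Commute.orderOf_mul_dvd_lcm`.)  Applied to the `H`-parts of the three local monodromies of a `G`-cover of `ℙ¹` branched at
three points (`H = ker χ_K` abelian), this is the divisibility constraint of `sum_inv_three_le_of_dvd_lcm`.
[locator HABITAT-G41 §1.3]  research route, not a corollary; conditional on HC_CM plus one named minimal statement. -/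
theorem orderOf_dvd_lcm_of_mul_mul_eq_one (x y z : A) (h : x * y * z = 1) :
    orderOf z ∣ Nat.lcm (orderOf x) (orderOf y) := by
  have hz : z = (x * y)⁻¹ := eq_inv_of_mul_eq_one_right h
  rw [hz, orderOf_inv]
  exact (Commute.all x y).orderOf_mul_dvd_lcm

/-- The three cyclic versions at once.  research route, not a corollary; conditional on HC_CM plus one named minimal statement. -/
theorem orderOf_dvd_lcm_three (x y z : A) (h : x * y * z = 1) :
    orderOf z ∣ Nat.lcm (orderOf x) (orderOf y) ∧ orderOf x ∣ Nat.lcm (orderOf y) (orderOf z) ∧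
      orderOf y ∣ Nat.lcm (orderOf z) (orderOf x) := by
  refine ⟨orderOf_dvd_lcm_of_mul_mul_eq_one x y z h, orderOf_dvd_lcm_of_mul_mul_eq_one y z x ?_,
    orderOf_dvd_lcm_of_mul_mul_eq_one z x y ?_⟩
  · calc y * z * x = x * y * z := by rw [mul_comm (y * z) x, mul_assoc]
      _ = 1 := h
  · calc z * x * y = x * y * z := by rw [mul_comm z x, mul_assoc, mul_comm z y, ← mul_assoc]
      _ = 1 := h

/-- Commuting elements of coprime orders `2` and `3` have a product of order `6`: in an abelian `H` a product-one triple of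
orders `(2, 3, d)` has `d = 6` — the extremal hyperbolic triple `(2,3,7)` never occurs.
research route, not a corollary; conditional on HC_CM plus one named minimal statement. -/
theorem orderOf_mul_eq_six {x y : A} (hx : orderOf x = 2) (hy : orderOf y = 3) : orderOf (x * y) = 6 := by
  have hco : Nat.Coprime (orderOf x) (orderOf y) := by rw [hx, hy]; decide
  rw [(Commute.all x y).orderOf_mul_eq_mul_orderOf_of_coprime hco, hx, hy]

end abelian

section bounds

/-- **Number of branch points.**  If `r` numbers `c_i ≥ N/2` sum to `2n + 2N` then `r N ≤ 4n + 4N` (so `r ≤ 4 + 4n/N`: a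
balanced `(n,n)` Galois–Prym datum over `ℙ¹` has at most `4 + 4n/|H|` points, and families of dimension `r − 3 ≥ 2` need
`|H| ≤ 4n`).  [locator HABITAT-G41 §1.2]  research route, not a corollary; conditional on HC_CM plus one named minimal statement. -/
theorem card_mul_le_of_half_le {r : ℕ} (N n : ℚ) (c : Fin r → ℚ) (hc : ∀ i, N / 2 ≤ c i)
    (hs : ∑ i, c i = 2 * n + 2 * N) : (r:ℚ) * N ≤ 4 * n + 4 * N := by
  have h : ∑ _i : Fin r, N / 2 ≤ ∑ i, c i := Finset.sum_le_sum fun i _ => hc i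
  rw [Finset.sum_const, Finset.card_univ, Fintype.card_fin, nsmul_eq_mul, hs] at h
  linarith

/-- **Rigid data, any `H`**: if `1/a + 1/b + 1/c = 1 − 2n/N` with `2 ≤ a ≤ b ≤ c`, `0 < n`, `0 < N`, then `N ≤ 84 n`.
[locator HABITAT-G41 §1.3]  research route, not a corollary; conditional on HC_CM plus one named minimal statement. -/
theorem level_le_of_three_point {a b c N n : ℕ} (ha : 2 ≤ a) (hab : a ≤ b) (hbc : b ≤ c) (hn : 0 < n) (hN : 0 < N)
    (h : (1:ℚ) / a + 1 / b + 1 / c = 1 - 2 * n / N) : N ≤ 84 * n := by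
  have hN' : (0:ℚ) < N := by exact_mod_cast hN
  have hn' : (0:ℚ) < n := by exact_mod_cast hn
  have hpos : (0:ℚ) < 2 * n / N := by positivity
  have hlt : (1:ℚ) / a + 1 / b + 1 / c < 1 := by rw [h]; linarith
  have hle := sum_inv_three_le ha hab hbc hlt
  rw [h] at hle
  have h42 : (1:ℚ) / 42 ≤ 2 * n / N := by linarith
  rw [div_le_div_iff₀ (by norm_num) hN'] at h42
  have : (N:ℚ) ≤ 84 * n := by linarith
  exact_mod_cast this

/-- **Rigid data, `H` abelian**: with the divisibilities of `orderOf_dvd_lcm_three`, `N ≤ 12 n`.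
[locator HABITAT-G41 §1.3]  research route, not a corollary; conditional on HC_CM plus one named minimal statement. -/
theorem level_le_of_three_point_abelian {a b c N n : ℕ} (ha : 2 ≤ a) (hab : a ≤ b) (hbc : b ≤ c)
    (h1 : c ∣ Nat.lcm a b) (h3 : a ∣ Nat.lcm b c) (hn : 0 < n) (hN : 0 < N)
    (h : (1:ℚ) / a + 1 / b + 1 / c = 1 - 2 * n / N) : N ≤ 12 * n := by
  have hN' : (0:ℚ) < N := by exact_mod_cast hN
  have hn' : (0:ℚ) < n := by exact_mod_cast hn
  have hpos : (0:ℚ) < 2 * n / N := by positivity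
  have hlt : (1:ℚ) / a + 1 / b + 1 / c < 1 := by rw [h]; linarith
  have hle := sum_inv_three_le_of_dvd_lcm ha hab hbc h1 h3 hlt
  rw [h] at hle
  have h6 : (1:ℚ) / 6 ≤ 2 * n / N := by linarith
  rw [div_le_div_iff₀ (by norm_num) hN'] at h6
  have : (N:ℚ) ≤ 12 * n := by linarith
  exact_mod_cast this

/-- **Four-point data** (`1`-parameter families): if `∑_{i<4} 1/d_i = 2 − 2n/N` with every term `≤ 1/2` and NOT all four
equal to `1/2` — here encoded as `1/d₁ + 1/d₂ + 1/d₃ + 1/d₄ ≤ 11/6`, the largest value below `2` (attained by `(2,2,2,3)`) —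
then `N ≤ 12 n`.  [locator HABITAT-G41 §1.3]  research route, not a corollary; conditional on HC_CM plus one named minimal statement. -/
theorem level_le_of_four_point {N n : ℕ} (s : ℚ) (hs : s ≤ 11 / 6) (hN : 0 < N)
    (h : s = 2 - 2 * n / N) : N ≤ 12 * n := by
  have hN' : (0:ℚ) < N := by exact_mod_cast hN
  have h6 : (1:ℚ) / 6 ≤ 2 * n / N := by linarith
  rw [div_le_div_iff₀ (by norm_num) hN'] at h6
  have : (N:ℚ) ≤ 12 * n := by linarith
  exact_mod_cast this

/-- The largest value `< 2` of a sum of four unit fractions `1/d`, `d ≥ 2`, is `11/6`: if `2 ≤ dᵢ` and the sum is `< 2`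
then it is `≤ 11/6`.  research route, not a corollary; conditional on HC_CM plus one named minimal statement. -/
theorem sum_inv_four_le {a b c d : ℕ} (ha : 2 ≤ a) (hb : 2 ≤ b) (hc : 2 ≤ c) (hd : 2 ≤ d)
    (hlt : (1:ℚ) / a + 1 / b + 1 / c + 1 / d < 2) : (1:ℚ) / a + 1 / b + 1 / c + 1 / d ≤ 11 / 6 := by
  have ea : (1:ℚ) / a ≤ 1 / 2 := one_div_le_of_le (by norm_num) ha
  have eb : (1:ℚ) / b ≤ 1 / 2 := one_div_le_of_le (by norm_num) hb
  have ec : (1:ℚ) / c ≤ 1 / 2 := one_div_le_of_le (by norm_num) hc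
  have ed : (1:ℚ) / d ≤ 1 / 2 := one_div_le_of_le (by norm_num) hd
  -- one of them is ≥ 3 (else the sum is 2)
  by_cases h3 : 3 ≤ a ∨ 3 ≤ b ∨ 3 ≤ c ∨ 3 ≤ d
  · rcases h3 with h | h | h | h
    · have := one_div_le_of_le (m := 3) (by norm_num) h; norm_num at this ea eb ec ed hlt ⊢; linarith
    · have := one_div_le_of_le (m := 3) (by norm_num) h; norm_num at this ea eb ec ed hlt ⊢; linarith
    · have := one_div_le_of_le (m := 3) (by norm_num) h; norm_num at this ea eb ec ed hlt ⊢; linarith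
    · have := one_div_le_of_le (m := 3) (by norm_num) h; norm_num at this ea eb ec ed hlt ⊢; linarith
  · simp only [not_or, not_le] at h3
    obtain ⟨h3a, h3b, h3c, h3d⟩ := h3
    interval_cases a; interval_cases b; interval_cases c; interval_cases d
    norm_num at hlt

end bounds

section abelian_four

/-- **Four points, `H` abelian** (appended gen 41 v2).  If `2 ≤ a ≤ b ≤ c ≤ d`, the sum of the four unit fractions is `< 2`,
and the configuration «three involutions and a fourth element of order `≥ 3`» is excluded (`a = b = c = 2 → d ≤ 2`: in an abelian
group the product of three involutions has order `≤ 2`, see `orderOf_mul_mul_dvd_two`), then the sum is `≤ 5/3` (`(2,2,3,3)` is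
extremal).  [locator HABITAT-G41 §1.3, case `r = 4`]
research route, not a corollary; conditional on HC_CM plus one named minimal statement. -/
theorem sum_inv_four_le_of_abelian {a b c d : ℕ} (ha : 2 ≤ a) (hab : a ≤ b) (hbc : b ≤ c) (hcd : c ≤ d)
    (hexcl : a = 2 → b = 2 → c = 2 → d ≤ 2)
    (hlt : (1:ℚ) / a + 1 / b + 1 / c + 1 / d < 2) : (1:ℚ) / a + 1 / b + 1 / c + 1 / d ≤ 5 / 3 := by
  have ea : (1:ℚ) / a ≤ 1 / 2 := one_div_le_of_le (by norm_num) ha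
  have eb : (1:ℚ) / b ≤ 1 / 2 := one_div_le_of_le (by norm_num) (le_trans ha hab)
  rcases (Nat.lt_or_ge c 3).symm with h3 | h3
  · have ec : (1:ℚ) / c ≤ 1 / 3 := one_div_le_of_le (by norm_num) h3
    have ed : (1:ℚ) / d ≤ 1 / 3 := one_div_le_of_le (by norm_num) (le_trans h3 hcd)
    linarith
  · -- c ≤ 2, hence a = b = c = 2 and d ≤ 2, d = 2: the sum is 2, contradicting hlt
    have hc2 : c = 2 := le_antisymm (by omega) (le_trans ha (le_trans hab hbc))
    have hb2 : b = 2 := le_antisymm (by omega) (le_trans ha hab)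
    have ha2 : a = 2 := le_antisymm (by omega) ha
    have hd2 : d = 2 := le_antisymm (hexcl ha2 hb2 hc2) (by omega)
    subst ha2; subst hb2; subst hc2; subst hd2
    norm_num at hlt

/-- Level bound for four-point data when `H` is abelian: `s ≤ 5/3` and `s = 2 − 2n/N` give `N ≤ 6 n`.
[locator HABITAT-G41 §1.3]  research route, not a corollary; conditional on HC_CM plus one named minimal statement. -/
theorem level_le_of_four_point_abelian {N n : ℕ} (s : ℚ) (hs : s ≤ 5 / 3) (hN : 0 < N)
    (h : s = 2 - 2 * n / N) : N ≤ 6 * n := by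
  have hN' : (0:ℚ) < N := by exact_mod_cast hN
  have h6 : (1:ℚ) / 3 ≤ 2 * n / N := by linarith
  rw [div_le_div_iff₀ (by norm_num) hN'] at h6
  have : (N:ℚ) ≤ 6 * n := by linarith
  exact_mod_cast this

variable {A : Type*} [CommGroup A]

/-- In a commutative group the product of three elements of order dividing `2` has order dividing `2` — so a product-one
quadruple `s₁ s₂ s₃ s₄ = 1` with three involutions forces `orderOf s₄ ∣ 2`: the configuration `(2,2,2,d)`, `d ≥ 3`, does not occur.
[locator HABITAT-G41 §1.3]  research route, not a corollary; conditional on HC_CM plus one named minimal statement. -/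
theorem orderOf_mul_mul_dvd_two {x y z : A} (hx : orderOf x ∣ 2) (hy : orderOf y ∣ 2) (hz : orderOf z ∣ 2) :
    orderOf (x * y * z) ∣ 2 := by
  have hx2 : x ^ 2 = 1 := orderOf_dvd_iff_pow_eq_one.mp hx
  have hy2 : y ^ 2 = 1 := orderOf_dvd_iff_pow_eq_one.mp hy
  have hz2 : z ^ 2 = 1 := orderOf_dvd_iff_pow_eq_one.mp hz
  apply orderOf_dvd_iff_pow_eq_one.mpr
  rw [mul_pow, mul_pow, hx2, hy2, hz2, one_mul, one_mul]

/-- The fourth element of a product-one quadruple with three involution-type factors has order dividing `2`.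
research route, not a corollary; conditional on HC_CM plus one named minimal statement. -/
theorem orderOf_fourth_dvd_two {x y z w : A} (hx : orderOf x ∣ 2) (hy : orderOf y ∣ 2) (hz : orderOf z ∣ 2)
    (h : x * y * z * w = 1) : orderOf w ∣ 2 := by
  have hw : w = (x * y * z)⁻¹ := eq_inv_of_mul_eq_one_right h
  rw [hw, orderOf_inv]
  exact orderOf_mul_mul_dvd_two hx hy hz

end abelian_four

end Summit.HodgeConjecture.Ring2AbelianAll.GaloisPrymFiniteness
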